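import Literature.Analysis.FluidPDE.ClassicalBoundedWeak
import Literature.Analysis.FluidPDE.ClassicalSolutionRescale
import Literature.Analysis.FluidPDE.ClassicalSolutionGlue
import Literature.Analysis.FluidPDE.SereginSverakBlowupSelection
import HarnessLib

/-!
# KNSS 2009, proof of Theorem 6.1: the zoom-in (near-maximum selection and the rescaled
# solutions)

Analysis/FluidPDE support file (proved lemmas) for the discharge path of
`Literature.Analysis.FluidPDE.KNSS2009_regularity_bound_C_over_r` (Koch–Nadirashvili–Seregin–Šverák,
Acta Math. 203 (2009) = arXiv:0709.3599, Thm. 6.1). The printed proof (p. 12) applies "the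
re-scaling procedure described in the paragraph preceding Proposition 6.1" (p. 11): with
`h(t) = sup_x |u(x, t)|`, `H(t) = sup_{s ≤ t} h(s)`, times `t_k ↗ T` and points `x_k` with
`M_k = |u(x_k, t_k)| ≥ H(t_k)/γ_k`, the functions (6.2)
`v^{(k)}(y, s) = M_k⁻¹ u(x_k + y/M_k, t_k + s/M_k²)` are solutions on `ℝⁿ × (A_k, B_k)`,
`A_k = −M_k² t_k → −∞`, with `|v^{(k)}| ≤ γ_k` on `(A_k, 0]` and `|v^{(k)}(0, 0)| = 1`; under
(6.4) `|u| ≤ C/|x'|` one has `|x'_k| ≤ C/M_k`, so `v^{(k)}` is "axi-symmetric with respect to an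
axis parallel to the `y₃`-axis at distance at most `C` from it". This file proves these
elementary facts for classical solutions (`IsClassicalNSSolutionOn (Ioo 0 T)`, the class of the
tree's rendering of Theorem 6.1), with `γ_k = 2` and the rescaling centred ON the axis (at
`x_{k,3} e₃`, so that the rescaled slices are axisymmetric about the fixed `x₃`-axis and the
near-maximum sits at the bounded offset `a_k = M_k (x_k)'`, `‖a_k‖ ≤ C`):

* `exists_near_max` — the near-maximum selection: if `u` is bounded on every `(0, T') × X`,
  `T' < T`, but not on `(0, T) × X`, then for every `R` there are `t₀ ∈ (0, T)`, `x₀` with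
  `‖u(t₀, x₀)‖ > R` and `‖u(s, y)‖ ≤ 2‖u(t₀, x₀)‖` for all `0 < s ≤ t₀` (a `sup` over
  `(0, t₀] × X`, no continuity needed);
* `zoom_isClassicalNSSolutionOn`, `zoom_norm_le_two`, `zoom_isAxisymmetric`,
  `zoom_cylRadius_mul_norm_le`, `zoom_apply_zero_offset`, `norm_zoom_offset_le` — the rescaled
  pair `c u(t₀ + c² s, x₀₃ e₃ + c y)`, `c² p(…)`, `c = ‖u(t₀, x₀)‖⁻¹`, is a classical solution on
  `(−t₀/c², (T − t₀)/c²)` (accepted covariance `IsClassicalNSSolutionOn.nsRescale_translate_zero`),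
  bounded by `2` up to the final time `s = 0`, with axisymmetric slices, the scale-invariant
  bound `|y'| ‖·‖ ≤ C`, value of norm `1` at `(0, a₀)`, `a₀ = c⁻¹ (x₀)'`, `‖a₀‖ ≤ C`;
* `lipschitz_up_to_final_time` — from a uniform Lipschitz bound on unit windows (the shape of
  `KNSS2009_regularity_boundedWeak_window.lipschitz_of_cylRadius_bound`, file
  `KNSSWindowLipschitz`) to a Lipschitz bound on `[A + 1, 0] × ℝ³` for a classical solution on
  `(A, B) ∋ 0` bounded by `2` on `(A, 0]` (windows `(σ − 1, σ)`, `σ ≤ 0`, translated to `(0, 1)`;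
  the final time `s = 0` by continuity; far-apart times by the bound `2`);
* `lipschitzWith_clamp` — clamping the time variable to `[A + 1, 0]` produces a globally
  Lipschitz map on `ℝ × ℝ³`, the input of the pointwise Arzelà–Ascoli extraction of
  `KNSSBlowupLimit`.

## References

* G. Koch, N. Nadirashvili, G. Seregin, V. Šverák, *Liouville theorems for the Navier–Stokes
  equations and applications*, Acta Math. 203 (2009) = arXiv:0709.3599: §6, the paragraph before
  Prop. 6.1 with (6.2)–(6.3) (p. 11), Theorem 6.1 and its proof (pp. 11–12).
  [KochNadirashviliSereginSverak2009]
-/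

noncomputable section

open MeasureTheory Set Function Filter Topology TopologicalSpace Metric
open scoped NNReal

namespace Literature.Analysis.FluidPDE

open SereginSverak2009

/-! ### The near-maximum selection -/

section Selection

variable {X F : Type*} [NormedAddCommGroup F]

/-- **Near-maximum selection** (KNSS 2009, §6, p. 11: "`H(t) = sup_{0≤s≤t} h(s)` … choose
`x_k ∈ ℝⁿ` such that `M_k = |u(x_k, t_k)| ≥ N_k/γ_k`", here with `γ_k = 2`). If
`u : ℝ → X → F` is bounded on `(0, T') × X` for every `T' < T` but not on `(0, T) × X`, then for
every `R` there are `t₀ ∈ (0, T)` and `x₀` with `R < ‖u(t₀, x₀)‖` and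
`‖u(s, y)‖ ≤ 2‖u(t₀, x₀)‖` for all `s ∈ (0, t₀]` and all `y` (take a value above `2 max(R, 0)`
at some time `s₁`, and a point of `(0, s₁] × X` where `‖u‖` exceeds half its supremum there). [cite: KochNadirashviliSereginSverak2009, §6 paragraph before Prop 6.1 (arXiv p. 11)] -/
theorem exists_near_max {u : ℝ → X → F} {T : ℝ}
    (hbdd : ∀ T' < T, ∃ M : ℝ, ∀ t ∈ Ioo 0 T', ∀ x, ‖u t x‖ ≤ M)
    (hunb : ¬ ∃ M : ℝ, ∀ t ∈ Ioo 0 T, ∀ x, ‖u t x‖ ≤ M) (R : ℝ) :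
    ∃ t₀ ∈ Ioo 0 T, ∃ x₀ : X, R < ‖u t₀ x₀‖ ∧
      ∀ s ∈ Ioc 0 t₀, ∀ y, ‖u s y‖ ≤ 2 * ‖u t₀ x₀‖ := by
  -- a large value at some time `s₁ < T`
  push Not at hunb
  obtain ⟨s₁, hs₁, x₁, hx₁⟩ := hunb (2 * max R 0)
  -- the supremum of `‖u‖` over `(0, s₁] × X`
  set S : Set ℝ := {r | ∃ s ∈ Ioc 0 s₁, ∃ y, r = ‖u s y‖} with hS
  obtain ⟨B, hB⟩ := hbdd ((s₁ + T) / 2) (by linarith [hs₁.2])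
  have hSbdd : BddAbove S := by
    refine ⟨B, ?_⟩
    rintro r ⟨s, hs, y, rfl⟩
    exact hB s ⟨hs.1, by linarith [hs.2, hs₁.2]⟩ y
  have hmem : ‖u s₁ x₁‖ ∈ S := ⟨s₁, ⟨hs₁.1, le_rfl⟩, x₁, rfl⟩
  have hSne : S.Nonempty := ⟨_, hmem⟩
  set N : ℝ := sSup S with hN
  have hN1 : ‖u s₁ x₁‖ ≤ N := le_csSup hSbdd hmem
  have hNpos : 0 < N := by
    have : 2 * max R 0 < N := hx₁.trans_le hN1
    nlinarith [le_max_right R 0]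
  obtain ⟨r, ⟨t₀, ht₀, x₀, rfl⟩, hr⟩ := exists_lt_of_lt_csSup hSne (half_lt_self hNpos)
  refine ⟨t₀, ⟨ht₀.1, ht₀.2.trans_lt hs₁.2⟩, x₀, ?_, fun s hs y => ?_⟩
  · have h1 : max R 0 < N / 2 := by linarith [hx₁.trans_le hN1]
    exact (le_max_left R 0).trans_lt (h1.trans hr)
  · have hsS : ‖u s y‖ ∈ S := ⟨s, ⟨hs.1, hs.2.trans ht₀.2⟩, y, rfl⟩
    linarith [le_csSup hSbdd hsS]

end Selection

/-! ### The rescaled solutions, centred on the axis -/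

section Zoom

variable {T : ℝ} {u : ℝ → (EuclideanSpace ℝ (Fin 3)) → (EuclideanSpace ℝ (Fin 3))} {p : ℝ → (EuclideanSpace ℝ (Fin 3)) → ℝ} {t₀ c : ℝ} {x₀ : (EuclideanSpace ℝ (Fin 3))}

/-- Times of `(−t₀/c², (T − t₀)/c²)` are mapped into `(0, T)` by `s ↦ t₀ + c² s` (`c ≠ 0`). [folklore] -/
theorem zoom_time_mem (hc : c ≠ 0) {s : ℝ} (hs : s ∈ Ioo (-(t₀ / c ^ 2)) ((T - t₀) / c ^ 2)) :
    t₀ + c ^ 2 * s ∈ Ioo 0 T := by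
  have hc2 : 0 < c ^ 2 := by positivity
  obtain ⟨h1, h2⟩ := hs
  have h1' := mul_lt_mul_of_pos_left h1 hc2
  rw [mul_neg, mul_div_cancel₀ _ hc2.ne'] at h1'
  have h2' := mul_lt_mul_of_pos_left h2 hc2
  rw [mul_div_cancel₀ _ hc2.ne'] at h2'
  exact ⟨by linarith, by linarith⟩

/-- Times of `(−t₀/c², 0]` are mapped into `(0, t₀]` by `s ↦ t₀ + c² s` (`c ≠ 0`). [folklore] -/
theorem zoom_time_mem_Ioc (hc : c ≠ 0) {s : ℝ} (hs : s ∈ Ioc (-(t₀ / c ^ 2)) 0) :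
    t₀ + c ^ 2 * s ∈ Ioc 0 t₀ := by
  have hc2 : 0 < c ^ 2 := by positivity
  obtain ⟨h1, h2⟩ := hs
  have h1' := mul_lt_mul_of_pos_left h1 hc2
  rw [mul_neg, mul_div_cancel₀ _ hc2.ne'] at h1'
  have h2' := mul_le_mul_of_nonneg_left h2 hc2.le
  rw [mul_zero] at h2'
  exact ⟨by linarith, by linarith⟩

/-- **The rescaled pair is a classical solution** (KNSS 2009, (6.2): "`v^{(k)}` are mild
solutions … in `ℝⁿ × (A_k, 0)`", here classical on the whole interval `(A, B)`,
`A = −t₀/c²`, `B = (T − t₀)/c² > 0`): for a classical solution `(u, p)` of the unforced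
system (`ν = 1`) on `(0, T) × ℝ³`, `t₀ ∈ (0, T)` and `c > 0`, the pair
`c u(t₀ + c² s, x₀₃ e₃ + c y)`, `c² p(…)` is a classical solution on `(A, B) × ℝ³`
(`IsClassicalNSSolutionOn.nsRescale_translate_zero`, restricted from the affine preimage). [cite: KochNadirashviliSereginSverak2009, §6 (6.2) (arXiv p. 11)] -/
theorem zoom_isClassicalNSSolutionOn (h : IsClassicalNSSolutionOn (Ioo 0 T) 1 0 u p) (hc : 0 < c)
    (t₀ : ℝ) (x₀ : (EuclideanSpace ℝ (Fin 3))) :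
    IsClassicalNSSolutionOn (Ioo (-(t₀ / c ^ 2)) ((T - t₀) / c ^ 2)) 1 0
      (c • stPull (c ^ 2) c t₀ (x₀ 2 • eZ) u) (c ^ 2 • stPull (c ^ 2) c t₀ (x₀ 2 • eZ) p) :=
  (h.nsRescale_translate_zero hc t₀ (x₀ 2 • eZ)).mono (fun _ hs => zoom_time_mem hc.ne' hs)
    (uniqueDiffOn_Ioo _ _)

/-- **The bound `|v| ≤ γ = 2` up to the final time** (KNSS 2009, (6.3) with `γ_k = 2`): if
`‖u(s, y)‖ ≤ 2‖u(t₀, x₀)‖` on `(0, t₀] × ℝ³` and `c = ‖u(t₀, x₀)‖⁻¹`, the rescaled velocity is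
bounded by `2` on `(−t₀/c², 0] × ℝ³`. [cite: KochNadirashviliSereginSverak2009, §6 (6.3) (arXiv p. 11)] -/
theorem zoom_norm_le_two (hsel : ∀ s ∈ Ioc 0 t₀, ∀ y, ‖u s y‖ ≤ 2 * ‖u t₀ x₀‖)
    (hM : 0 < ‖u t₀ x₀‖) (hc : c = ‖u t₀ x₀‖⁻¹) :
    ∀ s ∈ Ioc (-(t₀ / c ^ 2)) 0, ∀ y,
      ‖(c • stPull (c ^ 2) c t₀ (x₀ 2 • eZ) u) s y‖ ≤ 2 := by
  intro s hs y
  have hc0 : 0 < c := by rw [hc]; positivity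
  rw [smul_stPull_apply, norm_smul, Real.norm_eq_abs, abs_of_pos hc0]
  have h1 := hsel _ (zoom_time_mem_Ioc hc0.ne' hs) (x₀ 2 • eZ + c • y)
  calc c * ‖u (t₀ + c ^ 2 * s) (x₀ 2 • eZ + c • y)‖ ≤ c * (2 * ‖u t₀ x₀‖) :=
        mul_le_mul_of_nonneg_left h1 hc0.le
    _ = 2 := by rw [hc]; field_simp

/-- **The rescaled slices are axisymmetric** about the `x₃`-axis (the rescaling is centred on
the axis; KNSS 2009, proof of Thm. 6.1: "`v^{(k)}` are axi-symmetric with respect to an axis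
parallel to the `y₃`-axis"). [cite: KochNadirashviliSereginSverak2009, proof of Thm 6.1 (arXiv p. 12)] -/
theorem zoom_isAxisymmetric (haxi : ∀ t ∈ Ioo 0 T, IsAxisymmetric (u t)) {s : ℝ}
    (hs : t₀ + c ^ 2 * s ∈ Ioo 0 T) :
    IsAxisymmetric ((c • stPull (c ^ 2) c t₀ (x₀ 2 • eZ) u) s) :=
  isAxisymmetric_rescale (haxi _ hs) c (x₀ 2) c

/-- **The bound (6.4) is scale invariant**: `|y'| ‖c u(t, x₀₃ e₃ + c y)‖ = |x'| ‖u(t, x)‖` at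
`x = x₀₃ e₃ + c y` (`c > 0`), so the rescaled velocity obeys `|y'| ‖v‖ ≤ C` wherever `u` does
(KNSS 2009, proof of Thm. 6.1: "since assumption (6.4) is scale-invariant, it will again be
satisfied"). [cite: KochNadirashviliSereginSverak2009, proof of Thm 6.1 (arXiv p. 12)] -/
theorem zoom_cylRadius_mul_norm_le {C : ℝ} (hC : ∀ t ∈ Ioo 0 T, ∀ x, cylRadius x * ‖u t x‖ ≤ C)
    (hc : 0 < c) {s : ℝ} (hs : t₀ + c ^ 2 * s ∈ Ioo 0 T) (y : (EuclideanSpace ℝ (Fin 3))) :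
    cylRadius y * ‖(c • stPull (c ^ 2) c t₀ (x₀ 2 • eZ) u) s y‖ ≤ C := by
  rw [smul_stPull_apply, norm_smul, Real.norm_eq_abs, abs_of_pos hc]
  have h1 := hC _ hs (x₀ 2 • eZ + c • y)
  rw [cylRadius_smul_eZ_add, cylRadius_smul, abs_of_pos hc] at h1
  calc cylRadius y * (c * ‖u (t₀ + c ^ 2 * s) (x₀ 2 • eZ + c • y)‖)
      = c * cylRadius y * ‖u (t₀ + c ^ 2 * s) (x₀ 2 • eZ + c • y)‖ := by ring
    _ ≤ C := h1

/-- **The near-maximum in the rescaled picture**: at the final time `s = 0` and the offset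
`a₀ = c⁻¹ (x₀)'` the rescaled velocity is `c u(t₀, x₀)` (KNSS 2009, "`|v^{(k)}(0, 0)| = 1`",
here at `(0, a₀)` because the rescaling is centred on the axis). [cite: KochNadirashviliSereginSverak2009, §6 (6.3) (arXiv p. 11)] -/
theorem zoom_apply_zero_offset (hc : c ≠ 0) :
    (c • stPull (c ^ 2) c t₀ (x₀ 2 • eZ) u) 0 (c⁻¹ • horiz x₀) = c • u t₀ x₀ := by
  rw [smul_stPull_apply, mul_zero, add_zero, smul_inv_smul_horiz hc, add_comm, horiz_add_smul_eZ]

/-- Its norm is `1` when `c = ‖u(t₀, x₀)‖⁻¹ > 0`. [cite: KochNadirashviliSereginSverak2009, §6 (6.3) (arXiv p. 11)] -/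
theorem norm_zoom_apply_zero_offset (hM : 0 < ‖u t₀ x₀‖) (hc : c = ‖u t₀ x₀‖⁻¹) :
    ‖(c • stPull (c ^ 2) c t₀ (x₀ 2 • eZ) u) 0 (c⁻¹ • horiz x₀)‖ = 1 := by
  have hc0 : 0 < c := by rw [hc]; positivity
  rw [zoom_apply_zero_offset hc0.ne', norm_smul, Real.norm_eq_abs, abs_of_pos hc0, hc,
    inv_mul_cancel₀ hM.ne']

/-- **The offset is bounded by `C`** (KNSS 2009, proof of Thm. 6.1: "An obvious consequence of
assumption (6.4) is that `|x'_k| ≤ C/M_k`", i.e. `‖a₀‖ = M |x₀'| ≤ C` for `c = M⁻¹`,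
`M = ‖u(t₀, x₀)‖`). [cite: KochNadirashviliSereginSverak2009, proof of Thm 6.1 (arXiv p. 12)] -/
theorem norm_zoom_offset_le {C : ℝ} (hC : ∀ t ∈ Ioo 0 T, ∀ x, cylRadius x * ‖u t x‖ ≤ C)
    (ht₀ : t₀ ∈ Ioo 0 T) (hM : 0 < ‖u t₀ x₀‖) (hc : c = ‖u t₀ x₀‖⁻¹) :
    ‖c⁻¹ • horiz x₀‖ ≤ C := by
  have hc0 : 0 < c := by rw [hc]; positivity
  rw [norm_inv_smul_horiz hc0, hc, inv_inv, mul_comm]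
  exact hC t₀ ht₀ x₀

end Zoom

/-! ### Uniform Lipschitz bound up to the final time, and the clamped map -/

section Lipschitz

/-- **From unit windows to `[A + 1, 0]`, up to the final time.** Suppose a constant `K ≥ 0`
bounds the space–time Lipschitz modulus on `[1/2, 1) × ℝ³` of every bounded weak solution on
`ℝ³ × (0, 1)` that is continuous on the open slab, bounded by `2` and obeys `|x'| ‖·‖ ≤ C` (the
conclusion of `KNSS2009_regularity_boundedWeak_window.lipschitz_of_cylRadius_bound` at `M = 2`).
Let `(V, P)` be a classical solution of the unforced system (`ν = 1`) on `(A, B) × ℝ³` with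
`A ≤ −2 < 0 < B`, `‖V‖ ≤ 2` on `(A, 0] × ℝ³` and `|y'| ‖V‖ ≤ C` on `(A, B) × ℝ³`. Then
`‖V(t, x) − V(s, y)‖ ≤ max K 8 · (|t − s| + ‖x − y‖)` for all `s, t ∈ [A + 1, 0]`, `x, y`:
apply the window bound to the translates `V(· + σ − 1)` on `(0, 1)`, `σ ∈ [A + 1, 0]`
(classical, hence bounded weak, by `IsClassicalNSSolutionOn.isBoundedWeakNSSolutionOn`), which
covers pairs of times `< 0` at distance `< 1/2`; reach `t = 0` by continuity of `V` (a classical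
solution on `(A, B) ∋ 0`); pairs at distance `≥ 1/2` by `‖V‖ ≤ 2`. This is the equicontinuity,
uniform in `k` and up to `s = 0`, of the rescaled sequence in the proof of KNSS 2009, Thm. 6.1
("By Lemma 6.1 …", "`|v(0,0)| = 1`", arXiv p. 12). [cite: KochNadirashviliSereginSverak2009, Lemma 6.1 (p. 11) and proof of Thm 6.1 (p. 12)] -/
theorem lipschitz_up_to_final_time {K C : ℝ}
    (hKprop : ∀ ⦃w : ℝ → (EuclideanSpace ℝ (Fin 3)) → (EuclideanSpace ℝ (Fin 3))⦄, IsBoundedWeakNSSolutionOn (Ioo 0 1) isOpen_Ioo 1 w →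
      ContinuousOn (uncurry w) (Ioo (0 : ℝ) 1 ×ˢ univ) → (∀ t ∈ Ioo (0 : ℝ) 1, ∀ x, ‖w t x‖ ≤ 2) →
      (∀ t ∈ Ioo (0 : ℝ) 1, ∀ x, cylRadius x * ‖w t x‖ ≤ C) →
      ∀ s ∈ Ico (1 / 2 : ℝ) 1, ∀ t ∈ Ico (1 / 2 : ℝ) 1, ∀ x y : (EuclideanSpace ℝ (Fin 3)),
        ‖w t x - w s y‖ ≤ K * (|t - s| + ‖x - y‖))
    {A B : ℝ} (hA : A ≤ -2) (hB : 0 < B) {V : ℝ → (EuclideanSpace ℝ (Fin 3)) → (EuclideanSpace ℝ (Fin 3))} {P : ℝ → (EuclideanSpace ℝ (Fin 3)) → ℝ}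
    (hV : IsClassicalNSSolutionOn (Ioo A B) 1 0 V P) (hbd : ∀ s ∈ Ioc A 0, ∀ y, ‖V s y‖ ≤ 2)
    (hdec : ∀ s ∈ Ioo A B, ∀ y, cylRadius y * ‖V s y‖ ≤ C) :
    ∀ s ∈ Icc (A + 1) 0, ∀ t ∈ Icc (A + 1) 0, ∀ x y : (EuclideanSpace ℝ (Fin 3)),
      ‖V t x - V s y‖ ≤ max K 8 * (|t - s| + ‖x - y‖) := by
  -- (i) the window bound, translated: times in `[σ - 1/2, σ)`, `σ ∈ [A + 1, 0]`
  have hwin : ∀ σ ∈ Icc (A + 1) 0, ∀ r₁ ∈ Ico (σ - 1 / 2) σ, ∀ r₂ ∈ Ico (σ - 1 / 2) σ,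
      ∀ x y : (EuclideanSpace ℝ (Fin 3)), ‖V r₂ x - V r₁ y‖ ≤ K * (|r₂ - r₁| + ‖x - y‖) := by
    intro σ hσ r₁ hr₁ r₂ hr₂ x y
    set w : ℝ → (EuclideanSpace ℝ (Fin 3)) → (EuclideanSpace ℝ (Fin 3)) := fun τ => V (τ + (σ - 1)) with hw_def
    have hmem : ∀ τ ∈ Ioo (0 : ℝ) 1, τ + (σ - 1) ∈ Ioo A B := fun τ hτ =>
      ⟨by linarith [hτ.1, hσ.1], by linarith [hτ.2, hσ.2]⟩
    have hw : IsClassicalNSSolutionOn (Ioo 0 1) 1 (fun τ => (0 : ℝ → (EuclideanSpace ℝ (Fin 3)) → (EuclideanSpace ℝ (Fin 3))) (τ + (σ - 1))) w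
        (fun τ => P (τ + (σ - 1))) :=
      (hV.comp_add_right (σ - 1)).mono (fun τ hτ => hmem τ hτ) (uniqueDiffOn_Ioo 0 1)
    have h0 : (fun τ : ℝ => (0 : ℝ → (EuclideanSpace ℝ (Fin 3)) → (EuclideanSpace ℝ (Fin 3))) (τ + (σ - 1))) = 0 := by
      funext τ; rfl
    have hw' : IsClassicalNSSolutionOn (Ioo 0 1) 1 0 w (fun τ => P (τ + (σ - 1))) := by
      rw [h0] at hw; exact hw
    have hwbd : ∀ τ ∈ Ioo (0 : ℝ) 1, ∀ z, ‖w τ z‖ ≤ 2 := fun τ hτ z =>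
      hbd _ ⟨(hmem τ hτ).1, by linarith [hτ.2, hσ.2]⟩ z
    have hweak := hw'.isBoundedWeakNSSolutionOn ⟨2, hwbd⟩
    have hwc : ContinuousOn (uncurry w) (Ioo (0 : ℝ) 1 ×ˢ univ) := hw'.smooth_velocity.continuousOn
    have hwdec : ∀ τ ∈ Ioo (0 : ℝ) 1, ∀ z, cylRadius z * ‖w τ z‖ ≤ C := fun τ hτ z =>
      hdec _ (hmem τ hτ) z
    have key := hKprop hweak hwc hwbd hwdec (r₁ - (σ - 1)) ⟨by linarith [hr₁.1], by linarith [hr₁.2]⟩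
      (r₂ - (σ - 1)) ⟨by linarith [hr₂.1], by linarith [hr₂.2]⟩ x y
    simp only [hw_def, sub_add_cancel] at key
    rwa [show r₂ - (σ - 1) - (r₁ - (σ - 1)) = r₂ - r₁ by ring] at key
  -- (ii) pairs of times `< 0` at distance `< 1/2`
  have hneg : ∀ s ∈ Ico (A + 1) 0, ∀ t ∈ Ico (A + 1) 0, |t - s| < 1 / 2 → ∀ x y : (EuclideanSpace ℝ (Fin 3)),
      ‖V t x - V s y‖ ≤ K * (|t - s| + ‖x - y‖) := by
    intro s hs t ht hts x y
    have hts' := abs_lt.1 hts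
    set σ : ℝ := min 0 (min s t + 1 / 2) with hσ
    have hσA : σ ∈ Icc (A + 1) 0 := by
      refine ⟨le_min (by linarith) ?_, min_le_left _ _⟩
      have := min_le_min hs.1 ht.1
      rw [min_self] at this
      linarith
    refine hwin σ hσA s ⟨?_, ?_⟩ t ⟨?_, ?_⟩ x y
    · have h1 : σ ≤ min s t + 1 / 2 := min_le_right _ _
      have h2 : min s t ≤ s := min_le_left _ _
      linarith
    · refine lt_min hs.2 ?_
      rcases le_total s t with h | h
      · rw [min_eq_left h]; linarith
      · rw [min_eq_right h]; linarith
    · have h1 : σ ≤ min s t + 1 / 2 := min_le_right _ _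
      have h2 : min s t ≤ t := min_le_right _ _
      linarith
    · refine lt_min ht.2 ?_
      rcases le_total s t with h | h
      · rw [min_eq_left h]; linarith
      · rw [min_eq_right h]; linarith
  -- (iii) up to the final time, by continuity of `V`
  have hcontV : ContinuousOn (uncurry V) (Ioo A B ×ˢ univ) := hV.smooth_velocity.continuousOn
  have hopen : IsOpen (Ioo A B ×ˢ (univ : Set (EuclideanSpace ℝ (Fin 3)))) := isOpen_Ioo.prod isOpen_univ
  have htend : ∀ r ∈ Icc (A + 1) 0, ∀ z : (EuclideanSpace ℝ (Fin 3)),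
      Tendsto (fun n : ℕ => V (min r (-(1 / ((n : ℝ) + 1)))) z) atTop (𝓝 (V r z)) := by
    intro r hr z
    have hseq : Tendsto (fun n : ℕ => min r (-(1 / ((n : ℝ) + 1)))) atTop (𝓝 r) := by
      have h0 : Tendsto (fun n : ℕ => -(1 / ((n : ℝ) + 1))) atTop (𝓝 0) := by
        simpa using (tendsto_one_div_add_atTop_nhds_zero_nat (𝕜 := ℝ)).neg
      have := (tendsto_const_nhds (x := r)).min h0
      rwa [min_eq_left hr.2] at this
    have hcat : ContinuousAt (uncurry V) (r, z) :=
      hcontV.continuousAt (hopen.mem_nhds ⟨⟨by linarith [hr.1], hr.2.trans_lt hB⟩, mem_univ z⟩)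
    exact hcat.tendsto.comp (hseq.prodMk_nhds tendsto_const_nhds)
  have hclose : ∀ s ∈ Icc (A + 1) 0, ∀ t ∈ Icc (A + 1) 0, |t - s| < 1 / 2 → ∀ x y : (EuclideanSpace ℝ (Fin 3)),
      ‖V t x - V s y‖ ≤ K * (|t - s| + ‖x - y‖) := by
    intro s hs t ht hts x y
    set sq : ℕ → ℝ := fun n => min s (-(1 / ((n : ℝ) + 1))) with hsq
    set tq : ℕ → ℝ := fun n => min t (-(1 / ((n : ℝ) + 1))) with htq
    have hneg1 : ∀ n : ℕ, -(1 / ((n : ℝ) + 1)) < 0 := fun n =>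
      neg_neg_of_pos (by positivity)
    have hge1 : ∀ n : ℕ, -1 ≤ -(1 / ((n : ℝ) + 1)) := fun n => by
      rw [neg_le_neg_iff, div_le_one (by positivity)]
      linarith [n.cast_nonneg (α := ℝ)]
    have hmemq : ∀ r ∈ Icc (A + 1) 0, ∀ n : ℕ, min r (-(1 / ((n : ℝ) + 1))) ∈ Ico (A + 1) 0 :=
      fun r hr n => ⟨le_min hr.1 (by linarith [hge1 n]), (min_le_right _ _).trans_lt (hneg1 n)⟩
    have hdist : ∀ n, |tq n - sq n| ≤ |t - s| := fun n => by
      have := abs_min_sub_min_le_max t (-(1 / ((n : ℝ) + 1))) s (-(1 / ((n : ℝ) + 1)))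
      rwa [sub_self, abs_zero, max_eq_left (abs_nonneg _)] at this
    have hn : ∀ n, ‖V (tq n) x - V (sq n) y‖ ≤ K * (|tq n - sq n| + ‖x - y‖) := fun n =>
      hneg (sq n) (hmemq s hs n) (tq n) (hmemq t ht n) ((hdist n).trans_lt hts) x y
    have hlhs : Tendsto (fun n => ‖V (tq n) x - V (sq n) y‖) atTop (𝓝 ‖V t x - V s y‖) :=
      ((htend t ht x).sub (htend s hs y)).norm
    have hrhs : Tendsto (fun n => K * (|tq n - sq n| + ‖x - y‖)) atTop
        (𝓝 (K * (|t - s| + ‖x - y‖))) := by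
      have h1 : Tendsto tq atTop (𝓝 t) := by
        have := htend t ht x
        have h0 : Tendsto (fun n : ℕ => -(1 / ((n : ℝ) + 1))) atTop (𝓝 0) := by
          simpa using (tendsto_one_div_add_atTop_nhds_zero_nat (𝕜 := ℝ)).neg
        have := (tendsto_const_nhds (x := t)).min h0
        rwa [min_eq_left ht.2] at this
      have h2 : Tendsto sq atTop (𝓝 s) := by
        have h0 : Tendsto (fun n : ℕ => -(1 / ((n : ℝ) + 1))) atTop (𝓝 0) := by
          simpa using (tendsto_one_div_add_atTop_nhds_zero_nat (𝕜 := ℝ)).neg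
        have := (tendsto_const_nhds (x := s)).min h0
        rwa [min_eq_left hs.2] at this
      exact (((continuous_abs.tendsto _).comp (h1.sub h2)).add tendsto_const_nhds).const_mul K
    exact le_of_tendsto_of_tendsto' hlhs hrhs hn
  -- (iv) far-apart times by the bound `2`
  intro s hs t ht x y
  have hKle : K ≤ max K 8 := le_max_left _ _
  have hsum0 : 0 ≤ |t - s| + ‖x - y‖ := by positivity
  by_cases hts : |t - s| < 1 / 2
  · exact (hclose s hs t ht hts x y).trans (mul_le_mul_of_nonneg_right hKle hsum0)
  · have h1 : ‖V t x‖ ≤ 2 := hbd t ⟨by linarith [ht.1], ht.2⟩ x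
    have h2 : ‖V s y‖ ≤ 2 := hbd s ⟨by linarith [hs.1], hs.2⟩ y
    have h3 : 1 / 2 ≤ |t - s| := not_lt.1 hts
    calc ‖V t x - V s y‖ ≤ ‖V t x‖ + ‖V s y‖ := norm_sub_le _ _
      _ ≤ 8 * (|t - s| + ‖x - y‖) := by nlinarith [norm_nonneg (x - y)]
      _ ≤ max K 8 * (|t - s| + ‖x - y‖) := mul_le_mul_of_nonneg_right (le_max_right _ _) hsum0

/-- **Clamping the time to `[A + 1, 0]`.** If `‖V(t, x) − V(s, y)‖ ≤ K' (|t − s| + ‖x − y‖)`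
for `s, t ∈ [A + 1, 0]` (`A + 1 ≤ 0`, `K' ≥ 0`), then
`(t, x) ↦ V(max(A + 1, min(t, 0)), x)` is `2K'`-Lipschitz on `ℝ × ℝ³` (sup metric on the
product; the clamp is `1`-Lipschitz). [folklore] -/
theorem lipschitzWith_clamp {K' A : ℝ} (hK' : 0 ≤ K') (hA : A + 1 ≤ 0) {V : ℝ → (EuclideanSpace ℝ (Fin 3)) → (EuclideanSpace ℝ (Fin 3))}
    (hLip : ∀ s ∈ Icc (A + 1) 0, ∀ t ∈ Icc (A + 1) 0, ∀ x y : (EuclideanSpace ℝ (Fin 3)),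
      ‖V t x - V s y‖ ≤ K' * (|t - s| + ‖x - y‖)) :
    LipschitzWith (Real.toNNReal (2 * K'))
      (fun z : ℝ × (EuclideanSpace ℝ (Fin 3)) => V (max (A + 1) (min z.1 0)) z.2) := by
  refine LipschitzWith.of_dist_le_mul fun z z' => ?_
  have hcl : ∀ r : ℝ, max (A + 1) (min r 0) ∈ Icc (A + 1) 0 := fun r =>
    ⟨le_max_left _ _, max_le hA (min_le_right _ _)⟩
  have hcl1 : |max (A + 1) (min z.1 0) - max (A + 1) (min z'.1 0)| ≤ |z.1 - z'.1| := by
    refine (abs_max_sub_max_le_max _ _ _ _).trans ?_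
    rw [sub_self, abs_zero]
    refine max_le (abs_nonneg _) ((abs_min_sub_min_le_max _ _ _ _).trans ?_)
    rw [sub_self, abs_zero, max_eq_left (abs_nonneg _)]
  rw [dist_eq_norm, Real.coe_toNNReal _ (by positivity)]
  have h1 := hLip _ (hcl z'.1) _ (hcl z.1) z.2 z'.2
  have h2 : |z.1 - z'.1| ≤ dist z z' := by
    rw [← Real.dist_eq, Prod.dist_eq]; exact le_max_left _ _
  have h3 : ‖z.2 - z'.2‖ ≤ dist z z' := by
    rw [← dist_eq_norm, Prod.dist_eq]; exact le_max_right _ _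
  calc ‖V (max (A + 1) (min z.1 0)) z.2 - V (max (A + 1) (min z'.1 0)) z'.2‖
      ≤ K' * (|max (A + 1) (min z.1 0) - max (A + 1) (min z'.1 0)| + ‖z.2 - z'.2‖) := h1
    _ ≤ K' * (dist z z' + dist z z') := by gcongr; exact hcl1.trans h2
    _ = 2 * K' * dist z z' := by ring

end Lipschitz

end Literature.Analysis.FluidPDE

end
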